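import Summits.HodgeConjecture.HodgeConjecture.Theorems.H413FinPairRepGramTransport
import Literature.NumberTheory.GelbartRogawski1991.UnitaryDualPairWeilCoinvariants
import HarnessLib

/-!
# FLOOR-0 P4, seat S4′(i) ∕ S4b, junction (J-b) at the coinvariant level — `ω_V(t)` at the admissible line READ IN THE MODEL'S W-SPELLING, on the nose

Cell hodgecm-mathlib (D-0151), FLOOR 0, crux item H413 = stmt-HodgeConjecture-24833; programme P4, line `Cruxes/H413/Lines/F0_P4AdmissibleOccursInH1.lean`
(ed. 2), stub S4b `stub_T3a_holThetaAtAdmissibleLineOfRallisAt`.  Author F0P4-p01 (g0) (seat (i)); SEAT-i MEMO v2 §5, step (1) of the S4b assembly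
(NOTES HANDOFF).  `--supports stmt-HodgeConjecture-24833 --as helper`.  DEF-FREE.

S4b's carrier is the pin-spelled `omegaAtLine … a χ = Coinv (finPairRepW[diag dV, J_W a, chiSplittingLine θ (T_W a) (J_W a)]) (lineChar a χ)` at the ADMISSIBLE line `a`
(★ `Item6OmegaChiSplitting.sChiD … a` IS that `chiSplittingLine` by definition); the model's datum lives over `(diagonal (lineVec ↑a), chiSplitting θ (lineVec ↑a))`
(★ `Theorems/H413ThetaDistAtLine`, ★ `H413FinRepZeroTransportLaws`).  ★ `Theorems/H413FinPairRepGramTransport.finPairRep_TW_eq_finPairRep_lineVec` (p792671) identified the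
two finite Weil representations ELEMENT BY ELEMENT; this file lifts that to the `χ`-coinvariants:

* §1 `ker_eq_of_comp_surjective` — generic: if `ρW' h' = ρW (σ h')` and `χ' h' = χ (σ h')` along a SURJECTIVE map of groups `σ : H' → H` (same module), the two
  relation submodules of ★ `TwistedCoinv` coincide;
* §2 **`exists_coinv_equiv_TW_lineVec`** — for the pin data `(T_W a, J_W a, chiSplittingLine θ …)` (ANY proof arguments) and ANY character `χW` of `U(J_W a)(𝔸_f)`:
  an equivalence `Ψ : Coinv (finPairRepW[J_W a, chiSplittingLine]) χW ≃ₗ[ℂ] Coinv (finPairRepW[diagonal (lineVec ↑a), chiSplitting]) (χW ∘ subgroupCongr⁻¹)`, `Ψ (mk f) = mk f`,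
  intertwining the two `weilCoinv` actions of `U(diag dV)(𝔸_f)` ON THE NOSE (`Submodule.quotEquivOfEq`; the `W`-groups are ONE subgroup of `GL₁(𝔸_{L,f})`,
  ★ `finAdelic_JW_eq`, elements moved by `MulEquiv.subgroupCongr`).

With ★ `UnitaryDualPairWeilCoinvariantsReference.exists_weilCoinv_equiv_reference` (the model-spelled `chiSplitting` vs the model's chosen `splittingOf hGR₀`, up to the
finite twist character `χtw`) this yields the transport `Ψ`, `λ := χtw(·,1) ∘ ιVE` consumed by ★ `Theorems/H413HolRealOfTransport.exists_holReal_of_transport`.  (Knob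
note: `λ` need not be rational-trivial; the side's `ν` is the `U(V)`-part of the ADELIC twist `s_μ ∕ s_choose`, rational-trivial by compatibility.)
HC_CM is proved only modulo the printed citations until rung 0 closes.

## References
* [GelbartRogawski1991] S. Gelbart, J. Rogawski, Invent. Math. 105 (1991), §3.1 Prop. 3.1.1 p. 455, Remark p. 457 L4–13.
* [Liu2021] Y. Liu, Camb. J. Math. 9 (2021), Def. 4.11 (l. 2092–2096), App. D §D.1 Steps 1–3.
* Tree: ★ `Literature/RepresentationTheory/TwistedCoinvariants` (`ker`, `Coinv`, `mk`, `rep`), ★ `GelbartRogawski1991/UnitaryDualPairWeilCoinvariants` (`finPairRep(W)`,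
  `weilCoinv`, `weilCoinv_mk`), ★ `Theorems/H413FinPairRepGramTransport`.
-/

set_option autoImplicit false
set_option linter.dupNamespace false

noncomputable section

open scoped Matrix Kronecker
open NumberField IsDedekindDomain
open Literature.NumberTheory.Automorphic Literature.NumberTheory.Automorphic.UnitaryGroup
open Literature.NumberTheory.Weil1964
open Literature.NumberTheory.GelbartRogawski1991 Literature.NumberTheory.GelbartRogawski1991.UnitaryDualPair
open Literature.NumberTheory.GelbartRogawski1991.UnitaryDualPair.WeilCoinv
open Literature.NumberTheory.Automorphic.Liu2021.Def411WeilCarriersDoubling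
open Literature.NumberTheory.Automorphic.Liu2021.Def411WeilCarriers (TW JW JW_eq isSymm_TW isUnit_det_TW)
open Literature.NumberTheory.GelbartRogawski1991.GRConstruction (Fp)
open Literature.NumberTheory.GaloisRepresentations (HeckeCharacter)
open Literature.RepresentationTheory.HarrisKudlaSweet1996 (IsSplittingChar)

namespace Summit.HodgeConjecture.HodgeConjecture.Cruxes.H413.ThetaJunction

/-! ## §1 Relation submodules along a surjective change of the acting group -/

/-- **same relation submodule along a surjection of the acting group**: if `ρW' h' v = ρW (σ h') v` and `χ' h' = χ (σ h')` for a SURJECTIVE `σ : H' → H`,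
then `TwistedCoinv.ker ρW' χ' = TwistedCoinv.ker ρW χ` (same generators). [cite: GelbartRogawski1991, §3.1 Remark p. 457 L4–13] -/
theorem ker_eq_of_comp_surjective {k : Type*} [CommRing k] {H H' S : Type*} [Group H] [Group H'] [AddCommGroup S] [Module k S]
    {ρW : Representation k H S} {ρW' : Representation k H' S} {χ : H →* kˣ} {χ' : H' →* kˣ} (σ : H' → H) (hσ : Function.Surjective σ)
    (hρ : ∀ (h' : H') (v : S), ρW' h' v = ρW (σ h') v) (hχ : ∀ h' : H', χ' h' = χ (σ h')) :
    Literature.RepresentationTheory.TwistedCoinv.ker ρW' χ' = Literature.RepresentationTheory.TwistedCoinv.ker ρW χ := by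
  unfold Literature.RepresentationTheory.TwistedCoinv.ker
  congr 1
  ext x
  constructor
  · rintro ⟨⟨h', v⟩, rfl⟩
    exact ⟨⟨σ h', v⟩, by simp only [hρ, hχ]⟩
  · rintro ⟨⟨h, v⟩, rfl⟩
    obtain ⟨h', rfl⟩ := hσ h
    exact ⟨⟨h', v⟩, by simp only [hρ, hχ]⟩

/-! ## §2 The pin-spelled coinvariants at the admissible line ARE the model-spelled ones -/

section Line

variable (L : Type) [Field L] [NumberField L] [IsCMField L] {N' n' : ℕ} (e₁ : Fin N' × Fin 1 ≃ Fin n')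
  (dV₁ : Fin N' → L) (hdV₁ : ∀ i, IsCMField.complexConj L (dV₁ i) = dV₁ i) (hdV₁0 : ∀ i, dV₁ i ≠ 0)
  (θ : HeckeCharacter L) (hθu : θ.IsUnitary) (hθs : IsSplittingChar L 1 θ)
  (a : (↥(maximalRealSubfield L))ˣ)
  (hW : (TW (↥(maximalRealSubfield L)) a).IsSymm) (hWd : IsUnit (TW (↥(maximalRealSubfield L)) a).det)
  (hJW : JW (↥(maximalRealSubfield L)) L a = (TW (↥(maximalRealSubfield L)) a).map (algebraMap (↥(maximalRealSubfield L)) L))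
  (χW : UnitaryGroup.finAdelic (↥(maximalRealSubfield L)) L (IsCMField.complexConj L) 1 (JW (↥(maximalRealSubfield L)) L a) →* ℂˣ)

set_option maxHeartbeats 4000000 in
-- (the pair-datum telescopes of the two Weil representations; two `rfl`-level identifications + ★ p792671)
/-- **J-(b) ON THE COINVARIANTS.**  For the pin data `(T_W a, J_W a)` with the line splitting `chiSplittingLine θ` (ANY proof arguments — in particular the pin's
`isSymm_TW`∕`isUnit_det_TW`∕`JW_eq`, so that the source IS `omegaAtLine[sChiD θ] a χ` for `χW := lineChar a χ`) and ANY character `χW`: the `χW`-coinvariants are,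
ON THE NOSE and `U(diag dV)(𝔸_f)`-equivariantly, the coinvariants of the model-spelled finite Weil representation at `(diagonal (lineVec ↑a), chiSplitting θ (lineVec ↑a))`
for the character `χW` moved along `MulEquiv.subgroupCongr (finAdelic_JW_eq a)` (same underlying idèles). [cite: GelbartRogawski1991, §3.1 Prop. 3.1.1 p. 455; Remark p. 457]
[cite: Liu2021, Def. 4.11 (l. 2092–2096); App. D §D.1 Steps 1–3] -/
theorem exists_coinv_equiv_TW_lineVec :
    ∃ Ψ : Literature.RepresentationTheory.TwistedCoinv.Coinv
          (finPairRepW (↥(maximalRealSubfield L)) L (IsCMField.complexConj L) N' 1 e₁ (Matrix.diagonal dV₁) (JW (↥(maximalRealSubfield L)) L a)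
            (complexConj_imagUnit L) (imagUnit_ne_zero L) (imagUnit_mul_self L) (realDiagonal_isSymm L dV₁ hdV₁) hW
            (isUnit_det_realDiagonal L dV₁ hdV₁ hdV₁0) hWd (realDiagonal_map L dV₁ hdV₁).symm hJW
            (isCompatible_chiSplittingLine L e₁ dV₁ hdV₁ hdV₁0 θ hθu hθs (TW (↥(maximalRealSubfield L)) a) hW hWd
              (JW (↥(maximalRealSubfield L)) L a) hJW))
          χW ≃ₗ[ℂ]
        Literature.RepresentationTheory.TwistedCoinv.Coinv
          (finPairRepW (↥(maximalRealSubfield L)) L (IsCMField.complexConj L) N' 1 e₁ (Matrix.diagonal dV₁)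
            (Matrix.diagonal (lineVec L ((a : ↥(maximalRealSubfield L)) : L))) (complexConj_imagUnit L) (imagUnit_ne_zero L)
            (imagUnit_mul_self L) (realDiagonal_isSymm L dV₁ hdV₁) (realDiagonal_isSymm L _ (complexConj_lineVec_coe L a))
            (isUnit_det_realDiagonal L dV₁ hdV₁ hdV₁0) (isUnit_det_realDiagonal L _ (complexConj_lineVec_coe L a) (lineVec_coe_ne_zero L a))
            (realDiagonal_map L dV₁ hdV₁).symm (realDiagonal_map L _ (complexConj_lineVec_coe L a)).symm
            (isCompatible_chiSplitting L e₁ dV₁ hdV₁ hdV₁0 _ (complexConj_lineVec_coe L a) (lineVec_coe_ne_zero L a) θ hθu hθs))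
          (χW.comp (MulEquiv.subgroupCongr (finAdelic_JW_eq L a)).symm.toMonoidHom),
      (∀ f : FinSB (↥(maximalRealSubfield L)) (Fin N' × Fin 1),
          Ψ (Literature.RepresentationTheory.TwistedCoinv.mk _ χW f) = Literature.RepresentationTheory.TwistedCoinv.mk _ _ f) ∧
        ∀ (k : UnitaryGroup.finAdelic (↥(maximalRealSubfield L)) L (IsCMField.complexConj L) N' (Matrix.diagonal dV₁))
          (x : Literature.RepresentationTheory.TwistedCoinv.Coinv
            (finPairRepW (↥(maximalRealSubfield L)) L (IsCMField.complexConj L) N' 1 e₁ (Matrix.diagonal dV₁) (JW (↥(maximalRealSubfield L)) L a)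
              (complexConj_imagUnit L) (imagUnit_ne_zero L) (imagUnit_mul_self L) (realDiagonal_isSymm L dV₁ hdV₁) hW
              (isUnit_det_realDiagonal L dV₁ hdV₁ hdV₁0) hWd (realDiagonal_map L dV₁ hdV₁).symm hJW
              (isCompatible_chiSplittingLine L e₁ dV₁ hdV₁ hdV₁0 θ hθu hθs (TW (↥(maximalRealSubfield L)) a) hW hWd
                (JW (↥(maximalRealSubfield L)) L a) hJW))
            χW),
          Ψ (weilCoinv (↥(maximalRealSubfield L)) L (IsCMField.complexConj L) N' 1 e₁ (Matrix.diagonal dV₁) (JW (↥(maximalRealSubfield L)) L a)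
                (complexConj_imagUnit L) (imagUnit_ne_zero L) (imagUnit_mul_self L) (realDiagonal_isSymm L dV₁ hdV₁) hW
                (isUnit_det_realDiagonal L dV₁ hdV₁ hdV₁0) hWd (realDiagonal_map L dV₁ hdV₁).symm hJW χW
                (isCompatible_chiSplittingLine L e₁ dV₁ hdV₁ hdV₁0 θ hθu hθs (TW (↥(maximalRealSubfield L)) a) hW hWd
                  (JW (↥(maximalRealSubfield L)) L a) hJW) k x) =
            weilCoinv (↥(maximalRealSubfield L)) L (IsCMField.complexConj L) N' 1 e₁ (Matrix.diagonal dV₁)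
                (Matrix.diagonal (lineVec L ((a : ↥(maximalRealSubfield L)) : L))) (complexConj_imagUnit L) (imagUnit_ne_zero L)
                (imagUnit_mul_self L) (realDiagonal_isSymm L dV₁ hdV₁) (realDiagonal_isSymm L _ (complexConj_lineVec_coe L a))
                (isUnit_det_realDiagonal L dV₁ hdV₁ hdV₁0) (isUnit_det_realDiagonal L _ (complexConj_lineVec_coe L a) (lineVec_coe_ne_zero L a))
                (realDiagonal_map L dV₁ hdV₁).symm (realDiagonal_map L _ (complexConj_lineVec_coe L a)).symm
                (χW.comp (MulEquiv.subgroupCongr (finAdelic_JW_eq L a)).symm.toMonoidHom)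
                (isCompatible_chiSplitting L e₁ dV₁ hdV₁ hdV₁0 _ (complexConj_lineVec_coe L a) (lineVec_coe_ne_zero L a) θ hθu hθs) k
              (Ψ x) := by
  -- the two relation submodules of `𝒮((𝔸^∞)^{N'·1})` coincide: generators correspond along `subgroupCongr`, by ★ `finPairRep_TW_eq_finPairRep_lineVec`
  -- (never `rfl` on the underlying matrices of `subgroupCongr u` ∕ `1`: use the `simp` forms, the unfolding is prohibitively slow)
  refine ⟨Submodule.quotEquivOfEq _ _ ?_, fun f => rfl, fun k x => ?_⟩
  · refine ker_eq_of_comp_surjective (k := ℂ) (MulEquiv.subgroupCongr (finAdelic_JW_eq L a))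
      (MulEquiv.subgroupCongr (finAdelic_JW_eq L a)).surjective (fun u f => ?_) (fun u => ?_)
    · simp only [finPairRepW_apply]
      exact finPairRep_TW_eq_finPairRep_lineVec L e₁ dV₁ hdV₁ hdV₁0 θ hθu hθs a hW hWd hJW 1 u
        (MulEquiv.subgroupCongr (finAdelic_JW_eq L a) u) (MulEquiv.subgroupCongr_apply (finAdelic_JW_eq L a) u).symm f
    · simp only [MonoidHom.comp_apply, MulEquiv.coe_toMonoidHom, MulEquiv.symm_apply_apply]
  · obtain ⟨f, rfl⟩ := Literature.RepresentationTheory.TwistedCoinv.mk_surjective _ χW x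
    have hΨ : ∀ (p p' : Submodule ℂ (FinSB (↥(maximalRealSubfield L)) (Fin N' × Fin 1))) (h : p = p')
        (g : FinSB (↥(maximalRealSubfield L)) (Fin N' × Fin 1)),
        Submodule.quotEquivOfEq p p' h (Submodule.Quotient.mk g) = Submodule.Quotient.mk g := fun _ _ _ _ => rfl
    have h11 : (((1 : UnitaryGroup.finAdelic (↥(maximalRealSubfield L)) L (IsCMField.complexConj L) 1 (JW (↥(maximalRealSubfield L)) L a)) :
          GL (Fin 1) (FiniteAdeleRing (𝓞 L) L))) =
        ((1 : UnitaryGroup.finAdelic (↥(maximalRealSubfield L)) L (IsCMField.complexConj L) 1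
          (Matrix.diagonal (lineVec L ((a : ↥(maximalRealSubfield L)) : L)))) : GL (Fin 1) (FiniteAdeleRing (𝓞 L) L)) := by
      simp only [OneMemClass.coe_one]
    rw [weilCoinv_mk, Literature.RepresentationTheory.TwistedCoinv.mk_apply, Literature.RepresentationTheory.TwistedCoinv.mk_apply,
      hΨ, hΨ, ← Literature.RepresentationTheory.TwistedCoinv.mk_apply, ← Literature.RepresentationTheory.TwistedCoinv.mk_apply,
      weilCoinv_mk, finPairRep_TW_eq_finPairRep_lineVec L e₁ dV₁ hdV₁ hdV₁0 θ hθu hθs a hW hWd hJW k 1 1 h11 f]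

end Line

end Summit.HodgeConjecture.HodgeConjecture.Cruxes.H413.ThetaJunction

end
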